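import Mathlib
import Literature.Analysis.FluidPDE.PassiveVectorTensorModalAdjointCoeff
import Summits.AnomalousDissipation.AnomalousDissipation.Theorems.SolenoidalFractalHomogenisationLagrangianStepW7EngineSpine
import HarnessLib

/-!
# K1L_D (stmt-AnomalousDissipation-27980), W7 ENGINE S1b — DRAIN-FLOOR GEOMETRY of the three-mode chain
# (helper; `--supports stmt-AnomalousDissipation-27980 --as helper`)

The abstract slot step `W7Slot.slot_step` (p673119) consumes `hqw : ∀ t, q‖w₀ t‖² ≤ ‖P_{K₊} w₀ t‖² + ‖P_{K₋} w₀ t‖²` for the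
slow mode `w₀ ⊥ K₀` and its two chain neighbours `K_± = K₀ ± m`.  This file supplies it, with the explicit
`q = 2 − |m_⊥|²(1/|K₊|² + 1/|K₋|²)`, `|m_⊥|² = |m|² − (K₀·m)²/|K₀|²` (planner ad-ideate-p4 g13, memo
`Lines/onelevel-W7-threemode.md` §2: `Q̂ = 2α² + (c₊² + c₋²)β²`), and the scalar floor
`2(K₀·m)²/(|K₀|²(|m| + |K₀|)²) ≤ q` (`W7Engine.qmin_lower`, p670272) used by the period floor:
* `norm_sq_transversalProj` — Pythagoras for the Leray projection: `‖P_K z‖² = ‖z‖² − |K·z|²/|K|²`;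
* `norm_kdot_sq_le_of_kdot_eq_zero` — `|m·z|² ≤ |m_⊥|²‖z‖²` for `z ⊥ K₀`;
* **`drain_floor_pair`** — `q‖z‖² ≤ ‖P_{K₀+m} z‖² + ‖P_{K₀−m} z‖²`;
* `drain_floor_coeff_lower` — `2(K₀·m)²/(|K₀|²(√|m|² + √|K₀|²)²) ≤ q`.
Degenerate cases (`K₀ ± m = 0`) are covered by Lean's `x/0 = 0` (then `P_0 = id`).  W7 assembly owner: prover ad-sawtooth-k1loc-p1 g11.
No definitions, no sorry.  NOT a proof of the crux / of AD; rung F-D1.A0. [cite: BedrossianCotiZelati2017, §2 (hypocoercivity functional)] [problem: turb]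
-/

set_option linter.dupNamespace false

namespace Summit.AnomalousDissipation.AnomalousDissipation.Theorems.SolenoidalFractalHomogenisation.LagrangianStep.W7Slot

open scoped InnerProductSpace
open Literature.Analysis.FluidPDE Literature.Analysis.FluidPDE.Torus
open Literature.Analysis.FunctionSpaces.Torus (freqNormSq)

/-! ## §1 Pythagoras for the Leray projection -/

/-- `‖k‖² = |k|²` for the integer wave vector seen in `ℂ³`. -/
theorem norm_waveVecC_sq (K : Fin 3 → ℤ) : ‖waveVecC K‖ ^ 2 = freqNormSq K := by
  rw [EuclideanSpace.norm_sq_eq, freqNormSq]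
  refine Finset.sum_congr rfl fun j _ => ?_
  rw [waveVecC_apply]; norm_cast; simp [sq_abs]

/-- **Pythagoras for the Leray projection**: `‖P_K z‖² = ‖z‖² − |K·z|²/|K|²` (for `K = 0`, `P_0 = id` and `x/0 = 0`). -/
theorem norm_sq_transversalProj (K : Fin 3 → ℤ) (z : EuclideanSpace ℂ (Fin 3)) :
    ‖transversalProj K z‖ ^ 2 = ‖z‖ ^ 2 - ‖kdot K z‖ ^ 2 / freqNormSq K := by
  by_cases hK : K = 0
  · subst hK
    have h0 : freqNormSq (0 : Fin 3 → ℤ) = 0 := by simp [freqNormSq]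
    simp [transversalProj_apply, h0]
  have hF : 0 < freqNormSq K := freqNormSq_pos_of_ne_zero' hK
  have hFC : (freqNormSq K : ℂ) ≠ 0 := by exact_mod_cast hF.ne'
  set c : ℂ := (freqNormSq K : ℂ)⁻¹ * kdot K z with hc
  have hdec : z = transversalProj K z + c • waveVecC K := by
    rw [transversalProj_apply]; abel
  have horth : ⟪transversalProj K z, c • waveVecC K⟫_ℂ = 0 := by
    rw [inner_smul_right, ← inner_conj_symm, inner_waveVecC_left, kdot_transversalProj hK, map_zero, mul_zero]
  have hpy : ‖z‖ ^ 2 = ‖transversalProj K z‖ ^ 2 + ‖c • waveVecC K‖ ^ 2 := by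
    conv_lhs => rw [hdec]
    have h := @norm_add_sq_eq_norm_sq_add_norm_sq_of_inner_eq_zero ℂ _ _ _ _ _ _ horth
    simpa only [sq] using h
  have hcv : ‖c • waveVecC K‖ ^ 2 = ‖kdot K z‖ ^ 2 / freqNormSq K := by
    rw [norm_smul, mul_pow, norm_waveVecC_sq, hc, norm_mul, norm_inv, Complex.norm_real, Real.norm_eq_abs,
      abs_of_pos hF]
    field_simp
  rw [hpy, hcv]; ring

/-! ## §2 The transversal Cauchy–Schwarz bound -/

/-- `kdot` is additive in the wave vector. -/
theorem kdot_add_left (K L : Fin 3 → ℤ) (z : EuclideanSpace ℂ (Fin 3)) : kdot (K + L) z = kdot K z + kdot L z := by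
  simp only [kdot_apply, Pi.add_apply, Int.cast_add, add_mul, Finset.sum_add_distrib]

/-- `kdot` is odd in the wave vector. -/
theorem kdot_sub_left (K L : Fin 3 → ℤ) (z : EuclideanSpace ℂ (Fin 3)) : kdot (K - L) z = kdot K z - kdot L z := by
  simp only [kdot_apply, Pi.sub_apply, Int.cast_sub, sub_mul, Finset.sum_sub_distrib]

/-- **Transversal Cauchy–Schwarz**: for `z ⊥ K₀` (`K₀·z = 0`), `|m·z|² ≤ (|m|² − (K₀·m)²/|K₀|²)·‖z‖²`
(the component of `m` along `K₀` does not see `z`). -/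
theorem norm_kdot_sq_le_of_kdot_eq_zero (K0 m : Fin 3 → ℤ) {z : EuclideanSpace ℂ (Fin 3)} (hz : kdot K0 z = 0) :
    ‖kdot m z‖ ^ 2 ≤ (freqNormSq m - (∑ i, (K0 i : ℝ) * m i) ^ 2 / freqNormSq K0) * ‖z‖ ^ 2 := by
  set κ : ℝ := ∑ i, (K0 i : ℝ) * m i with hκ
  set F : ℝ := freqNormSq K0 with hFdef
  -- the real vector `m − (κ/F) K₀`, seen in `ℂ³`
  set a : EuclideanSpace ℂ (Fin 3) := WithLp.toLp 2 fun i => (((m i : ℝ) - κ / F * (K0 i : ℝ) : ℝ) : ℂ) with ha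
  have ha_apply : ∀ i, a i = (((m i : ℝ) - κ / F * (K0 i : ℝ) : ℝ) : ℂ) := fun i => rfl
  have hinner : ⟪a, z⟫_ℂ = kdot m z := by
    have h1 : ⟪a, z⟫_ℂ = ∑ i, (((m i : ℝ) - κ / F * (K0 i : ℝ) : ℝ) : ℂ) * z i := by
      rw [PiLp.inner_apply]
      refine Finset.sum_congr rfl fun i _ => ?_
      rw [RCLike.inner_apply, ha_apply, Complex.conj_ofReal, mul_comm]
    have h2 : ∑ i, (((m i : ℝ) - κ / F * (K0 i : ℝ) : ℝ) : ℂ) * z i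
        = kdot m z - ((κ / F : ℝ) : ℂ) * kdot K0 z := by
      rw [kdot_apply, kdot_apply, Finset.mul_sum, ← Finset.sum_sub_distrib]
      refine Finset.sum_congr rfl fun i _ => ?_
      push_cast; ring
    rw [h1, h2, hz, mul_zero, sub_zero]
  have hnorm_a : ‖a‖ ^ 2 = freqNormSq m - κ ^ 2 / F := by
    rw [EuclideanSpace.norm_sq_eq]
    have h1 : ∑ i, ‖a i‖ ^ 2 = ∑ i, ((m i : ℝ) - κ / F * (K0 i : ℝ)) ^ 2 := by
      refine Finset.sum_congr rfl fun i _ => ?_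
      rw [ha_apply, Complex.norm_real, Real.norm_eq_abs, sq_abs]
    rw [h1]
    have h2 : ∑ i, ((m i : ℝ) - κ / F * (K0 i : ℝ)) ^ 2
        = freqNormSq m - 2 * (κ / F) * κ + (κ / F) ^ 2 * F := by
      have eκ : κ = (K0 0 : ℝ) * m 0 + (K0 1 : ℝ) * m 1 + (K0 2 : ℝ) * m 2 := by rw [hκ, Fin.sum_univ_three]
      have eF : F = (K0 0 : ℝ) ^ 2 + (K0 1 : ℝ) ^ 2 + (K0 2 : ℝ) ^ 2 := by rw [hFdef, freqNormSq, Fin.sum_univ_three]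
      have eM : freqNormSq m = (m 0 : ℝ) ^ 2 + (m 1 : ℝ) ^ 2 + (m 2 : ℝ) ^ 2 := by rw [freqNormSq, Fin.sum_univ_three]
      rw [Fin.sum_univ_three, eM]
      set c : ℝ := κ / F
      rw [eκ, eF]
      ring
    rw [h2]
    by_cases hF0 : F = 0
    · rw [hF0]; simp
    · field_simp; ring
  have hcs : ‖kdot m z‖ ≤ ‖a‖ * ‖z‖ := by rw [← hinner]; exact norm_inner_le_norm a z
  have h0 : 0 ≤ ‖kdot m z‖ := norm_nonneg _
  calc ‖kdot m z‖ ^ 2 ≤ (‖a‖ * ‖z‖) ^ 2 := pow_le_pow_left₀ h0 hcs 2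
    _ = (freqNormSq m - κ ^ 2 / F) * ‖z‖ ^ 2 := by rw [mul_pow, hnorm_a]

/-! ## §3 The drain floor -/

/-- **Drain-floor geometry (pair form).**  For `z ⊥ K₀` and the chain neighbours `K₀ ± m`:
`(2 − |m_⊥|²(1/|K₀+m|² + 1/|K₀−m|²))·‖z‖² ≤ ‖P_{K₀+m} z‖² + ‖P_{K₀−m} z‖²`, `|m_⊥|² = |m|² − (K₀·m)²/|K₀|²`.
This is the hypothesis `hqw` of `W7Slot.slot_step`. [cite: BedrossianCotiZelati2017, §2 (hypocoercivity functional)] -/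
theorem drain_floor_pair (K0 m : Fin 3 → ℤ) {z : EuclideanSpace ℂ (Fin 3)} (hz : kdot K0 z = 0) :
    (2 - (freqNormSq m - (∑ i, (K0 i : ℝ) * m i) ^ 2 / freqNormSq K0)
        * (1 / freqNormSq (K0 + m) + 1 / freqNormSq (K0 - m))) * ‖z‖ ^ 2
      ≤ ‖transversalProj (K0 + m) z‖ ^ 2 + ‖transversalProj (K0 - m) z‖ ^ 2 := by
  set M : ℝ := freqNormSq m - (∑ i, (K0 i : ℝ) * m i) ^ 2 / freqNormSq K0 with hM
  have hp : kdot (K0 + m) z = kdot m z := by rw [kdot_add_left, hz, zero_add]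
  have hm : kdot (K0 - m) z = -kdot m z := by rw [kdot_sub_left, hz, zero_sub]
  rw [norm_sq_transversalProj, norm_sq_transversalProj, hp, hm, norm_neg]
  have hb := norm_kdot_sq_le_of_kdot_eq_zero K0 m hz
  rw [← hM] at hb
  have h1 : ‖kdot m z‖ ^ 2 / freqNormSq (K0 + m) ≤ M * ‖z‖ ^ 2 / freqNormSq (K0 + m) :=
    div_le_div_of_nonneg_right hb (Literature.Analysis.FunctionSpaces.Torus.freqNormSq_nonneg _)
  have h2 : ‖kdot m z‖ ^ 2 / freqNormSq (K0 - m) ≤ M * ‖z‖ ^ 2 / freqNormSq (K0 - m) :=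
    div_le_div_of_nonneg_right hb (Literature.Analysis.FunctionSpaces.Torus.freqNormSq_nonneg _)
  have hexp : (2 - M * (1 / freqNormSq (K0 + m) + 1 / freqNormSq (K0 - m))) * ‖z‖ ^ 2
      = ‖z‖ ^ 2 - M * ‖z‖ ^ 2 / freqNormSq (K0 + m) + (‖z‖ ^ 2 - M * ‖z‖ ^ 2 / freqNormSq (K0 - m)) := by ring
  rw [hexp]
  linarith

/-- `|K + L|² = |K|² + 2 K·L + |L|²` on `ℤ³`. -/
theorem freqNormSq_add_three (K L : Fin 3 → ℤ) :
    freqNormSq (K + L) = freqNormSq K + 2 * (∑ i, (K i : ℝ) * L i) + freqNormSq L := by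
  simp only [freqNormSq, Fin.sum_univ_three, Pi.add_apply, Int.cast_add]; ring

/-- `|K − L|² = |K|² − 2 K·L + |L|²` on `ℤ³`. -/
theorem freqNormSq_sub_three (K L : Fin 3 → ℤ) :
    freqNormSq (K - L) = freqNormSq K - 2 * (∑ i, (K i : ℝ) * L i) + freqNormSq L := by
  simp only [freqNormSq, Fin.sum_univ_three, Pi.sub_apply, Int.cast_sub]; ring

/-- Cauchy–Schwarz on `ℤ³`: `(K·L)² ≤ |K|²|L|²`. -/
theorem dot_sq_le_freqNormSq_mul (K L : Fin 3 → ℤ) :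
    (∑ i, (K i : ℝ) * L i) ^ 2 ≤ freqNormSq K * freqNormSq L := by
  have h := Finset.sum_mul_sq_le_sq_mul_sq Finset.univ (fun i => (K i : ℝ)) (fun i => (L i : ℝ))
  simpa [freqNormSq] using h

/-- The coefficient of `drain_floor_pair` is at most `2`. -/
theorem drain_floor_coeff_le_two (K0 m : Fin 3 → ℤ) :
    2 - (freqNormSq m - (∑ i, (K0 i : ℝ) * m i) ^ 2 / freqNormSq K0)
        * (1 / freqNormSq (K0 + m) + 1 / freqNormSq (K0 - m)) ≤ 2 := by
  have hM : 0 ≤ freqNormSq m - (∑ i, (K0 i : ℝ) * m i) ^ 2 / freqNormSq K0 := by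
    by_cases hF : freqNormSq K0 = 0
    · rw [hF, div_zero, sub_zero]; exact Literature.Analysis.FunctionSpaces.Torus.freqNormSq_nonneg _
    have hFp : 0 < freqNormSq K0 :=
      lt_of_le_of_ne (Literature.Analysis.FunctionSpaces.Torus.freqNormSq_nonneg _) (Ne.symm hF)
    rw [sub_nonneg, div_le_iff₀ hFp]
    have := dot_sq_le_freqNormSq_mul K0 m
    linarith [mul_comm (freqNormSq K0) (freqNormSq m)]
  have hS : 0 ≤ 1 / freqNormSq (K0 + m) + 1 / freqNormSq (K0 - m) := by
    have := Literature.Analysis.FunctionSpaces.Torus.freqNormSq_nonneg (K0 + m)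
    have := Literature.Analysis.FunctionSpaces.Torus.freqNormSq_nonneg (K0 - m)
    positivity
  linarith [mul_nonneg hM hS]

/-- One side of the scalar floor: `y² = G − M`, `G ≥ 0` ⇒ `(y/√G)² ≤ 1 − M/G` (equality unless `G = 0`). -/
theorem scalar_floor_side (G y M : ℝ) (hG : 0 ≤ G) (hy : y ^ 2 = G - M) :
    (y / Real.sqrt G) ^ 2 ≤ 1 - M * (1 / G) := by
  by_cases hG0 : G = 0
  · subst hG0
    rw [Real.sqrt_zero, div_zero]; simp
  have hGne : G ≠ 0 := hG0
  rw [div_pow, Real.sq_sqrt hG, hy]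
  have hcalc : (G - M) / G = 1 - M * (1 / G) := by field_simp
  rw [hcalc]

/-- A degenerate side of the scalar floor: `2k²/(N+k)² ≤ ((2k)/n)²` when `0 < n ≤ N + k`. -/
theorem scalar_floor_degenerate {k N n : ℝ} (hk : 0 < k) (hN : 0 ≤ N) (hn : 0 < n) (hn' : n ≤ N + k) :
    2 * k ^ 2 / (N + k) ^ 2 ≤ (2 * k / n) ^ 2 := by
  have hNk : 0 < N + k := by positivity
  have e1 : 2 * k ^ 2 / (N + k) ^ 2 ≤ (2 * k) ^ 2 / (N + k) ^ 2 := by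
    apply div_le_div_of_nonneg_right _ (by positivity); nlinarith [sq_nonneg k]
  have e2 : (2 * k) ^ 2 / (N + k) ^ 2 ≤ (2 * k / n) ^ 2 := by
    rw [div_pow]
    exact div_le_div_of_nonneg_left (sq_nonneg _) (by positivity) (pow_le_pow_left₀ hn.le hn' 2)
  exact e1.trans e2

/-- **Scalar drain floor** (all cases): with `F₊ = (k+x)² + M`, `F₋ = (k−x)² + M`, `x² + M = N²`, `M ≥ 0`, `k > 0`:
`2x²/(N+k)² ≤ 2 − M(1/F₊ + 1/F₋)` (`W7Engine.qmin_lower` off the degenerate sides `F_± = 0`). -/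
theorem scalar_floor {k N x M Fp Fm : ℝ} (hk : 0 < k) (hN : 0 ≤ N) (hM : 0 ≤ M) (hxM : x ^ 2 + M = N ^ 2)
    (hFp : Fp = (k + x) ^ 2 + M) (hFm : Fm = (k - x) ^ 2 + M) :
    2 * x ^ 2 / (N + k) ^ 2 ≤ 2 - M * (1 / Fp + 1 / Fm) := by
  have hNk : 0 < N + k := by positivity
  have hFpnn : 0 ≤ Fp := by rw [hFp]; positivity
  have hFmnn : 0 ≤ Fm := by rw [hFm]; positivity
  have habsx : |x| ≤ N := abs_le_of_sq_le_sq' (by linarith) hN |> fun h => abs_le.2 h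
  -- `n_± ≤ N + k`
  have hFp_le : Fp ≤ (N + k) ^ 2 := by rw [hFp]; nlinarith [le_abs_self x, hxM]
  have hFm_le : Fm ≤ (N + k) ^ 2 := by rw [hFm]; nlinarith [neg_abs_le x, hxM]
  have hroot : N + k = Real.sqrt ((N + k) ^ 2) := (Real.sqrt_sq hNk.le).symm
  have hnp : Real.sqrt Fp ≤ N + k := by rw [hroot]; exact Real.sqrt_le_sqrt hFp_le
  have hnm : Real.sqrt Fm ≤ N + k := by rw [hroot]; exact Real.sqrt_le_sqrt hFm_le
  have hP := scalar_floor_side Fp (k + x) M hFpnn (by rw [hFp]; ring)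
  have hMi := scalar_floor_side Fm (k - x) M hFmnn (by rw [hFm]; ring)
  have hsum : 1 - M * (1 / Fp) + (1 - M * (1 / Fm)) = 2 - M * (1 / Fp + 1 / Fm) := by ring
  rw [← hsum]
  refine le_trans ?_ (add_le_add hP hMi)
  by_cases hp0 : Real.sqrt Fp = 0
  · have hFp0 : Fp = 0 := by rwa [Real.sqrt_eq_zero hFpnn] at hp0
    have hkx0 : k + x = 0 := by
      have h0 : (k + x) ^ 2 = 0 := le_antisymm (by rw [hFp] at hFp0; linarith [sq_nonneg (k + x)]) (sq_nonneg _)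
      exact pow_eq_zero_iff two_ne_zero |>.1 h0
    have hxeq : x = -k := by linarith
    by_cases hm0 : Real.sqrt Fm = 0
    · exfalso
      have hFm0 : Fm = 0 := by rwa [Real.sqrt_eq_zero hFmnn] at hm0
      have h0 : (k - x) ^ 2 = 0 := le_antisymm (by rw [hFm] at hFm0; linarith [sq_nonneg (k - x)]) (sq_nonneg _)
      have : k - x = 0 := pow_eq_zero_iff two_ne_zero |>.1 h0
      linarith
    · have hmpos : 0 < Real.sqrt Fm := lt_of_le_of_ne (Real.sqrt_nonneg _) (Ne.symm hm0)
      rw [hp0, div_zero, zero_pow two_ne_zero, zero_add, hxeq, show k - -k = 2 * k by ring, neg_sq]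
      exact scalar_floor_degenerate hk hN hmpos hnm
  · have hppos : 0 < Real.sqrt Fp := lt_of_le_of_ne (Real.sqrt_nonneg _) (Ne.symm hp0)
    by_cases hm0 : Real.sqrt Fm = 0
    · have hFm0 : Fm = 0 := by rwa [Real.sqrt_eq_zero hFmnn] at hm0
      have hkx0 : k - x = 0 := by
        have h0 : (k - x) ^ 2 = 0 := le_antisymm (by rw [hFm] at hFm0; linarith [sq_nonneg (k - x)]) (sq_nonneg _)
        exact pow_eq_zero_iff two_ne_zero |>.1 h0
      have hxeq : x = k := by linarith
      rw [hm0, div_zero, zero_pow two_ne_zero, add_zero, hxeq, show k + k = 2 * k by ring]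
      exact scalar_floor_degenerate hk hN hppos hnp
    · have hmpos : 0 < Real.sqrt Fm := lt_of_le_of_ne (Real.sqrt_nonneg _) (Ne.symm hm0)
      exact W7Engine.qmin_lower hk hN hppos hmpos hnp hnm

/-- **Scalar drain floor on the lattice**: `2(K₀·m)²/(|K₀|²(√|m|² + √|K₀|²)²) ≤ 2 − |m_⊥|²(1/|K₀+m|² + 1/|K₀−m|²)`
for `K₀ ≠ 0` (`scalar_floor` with `k = |K₀|`, `x = (K₀·m)/|K₀|`, `N = |m|`, `M = |m_⊥|²`).
[cite: BedrossianCotiZelati2017, §2 (hypocoercivity functional)] -/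
theorem drain_floor_coeff_lower {K0 : Fin 3 → ℤ} (hK0 : K0 ≠ 0) (m : Fin 3 → ℤ) :
    2 * (∑ i, (K0 i : ℝ) * m i) ^ 2 / (freqNormSq K0 * (Real.sqrt (freqNormSq m) + Real.sqrt (freqNormSq K0)) ^ 2)
      ≤ 2 - (freqNormSq m - (∑ i, (K0 i : ℝ) * m i) ^ 2 / freqNormSq K0)
          * (1 / freqNormSq (K0 + m) + 1 / freqNormSq (K0 - m)) := by
  have hFp_eq := freqNormSq_add_three K0 m
  have hFm_eq := freqNormSq_sub_three K0 m
  have hcs := dot_sq_le_freqNormSq_mul K0 m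
  have hFpos : 0 < freqNormSq K0 := freqNormSq_pos_of_ne_zero' hK0
  have hN2nn : 0 ≤ freqNormSq m := Literature.Analysis.FunctionSpaces.Torus.freqNormSq_nonneg _
  set κ : ℝ := ∑ i, (K0 i : ℝ) * m i
  set F : ℝ := freqNormSq K0
  set N2 : ℝ := freqNormSq m
  have hk : 0 < Real.sqrt F := Real.sqrt_pos.2 hFpos
  have hk2 : Real.sqrt F ^ 2 = F := Real.sq_sqrt hFpos.le
  have hN2' : Real.sqrt N2 ^ 2 = N2 := Real.sq_sqrt hN2nn
  have hx2 : (κ / Real.sqrt F) ^ 2 = κ ^ 2 / F := by rw [div_pow, hk2]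
  have hkx : Real.sqrt F * (κ / Real.sqrt F) = κ := by field_simp
  have hMx : 0 ≤ N2 - κ ^ 2 / F := by
    rw [sub_nonneg, div_le_iff₀ hFpos]; linarith [mul_comm F N2]
  have h := scalar_floor (x := κ / Real.sqrt F) (M := N2 - κ ^ 2 / F) (Fp := freqNormSq (K0 + m))
    (Fm := freqNormSq (K0 - m)) hk (Real.sqrt_nonneg N2) hMx (by rw [hx2, hN2']; ring)
    (by have e : (Real.sqrt F + κ / Real.sqrt F) ^ 2 = Real.sqrt F ^ 2 + 2 * (Real.sqrt F * (κ / Real.sqrt F))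
          + (κ / Real.sqrt F) ^ 2 := by ring
        rw [e, hkx, hx2, hk2, hFp_eq]; ring)
    (by have e : (Real.sqrt F - κ / Real.sqrt F) ^ 2 = Real.sqrt F ^ 2 - 2 * (Real.sqrt F * (κ / Real.sqrt F))
          + (κ / Real.sqrt F) ^ 2 := by ring
        rw [e, hkx, hx2, hk2, hFm_eq]; ring)
  have hlhs : 2 * κ ^ 2 / (F * (Real.sqrt N2 + Real.sqrt F) ^ 2)
      = 2 * (κ / Real.sqrt F) ^ 2 / (Real.sqrt N2 + Real.sqrt F) ^ 2 := by
    rw [hx2]; field_simp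
  rw [hlhs]
  exact h

end Summit.AnomalousDissipation.AnomalousDissipation.Theorems.SolenoidalFractalHomogenisation.LagrangianStep.W7Slot
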